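import Literature.MathematicalPhysics.QuantumFieldTheory.Balaban1983to89.B9Thm39Sum
import Literature.MathematicalPhysics.QuantumFieldTheory.Balaban1983to89.B9Eq352DivFormLetters

/-!
# `Balaban1983to89.B9Thm39CinvUpperL` — [Balaban1985BackgroundPropagators] (3.95) p. 411 / [Balaban1984PropagatorsII] (2.83) p. 237: THE UPPER MAJORANT OF
# `G′(U)²` FROM THEOREM 3.1's (3.42)₁ — the product of two scale-weighted block majorants with the scale transfer of p. 398 and [4] Lemma 2.1 (the
# `(Lʲη)⁴`-weighted input `hL` of the first-sum estimate), generic in the geometry and the block map (cell `lit-balaban`, G-B9-LETTERS module M5.6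
# FILE 3a, seat p21 gen 31)

statement-level skeleton of published theorems with citation tags; proofs where landed; nothing here is a claim about the Yang–Mills mass gap

CITATION HEADER (lean-in-tree rule).  [4] = T. Bałaban, *Propagators and renormalization transformations for lattice gauge theories. II*, Commun. Math.
Phys. **96** (1984) 223–250, p. 237 (2.83), first line: «|(L^{j′}η)^d Σ_□ ((1 − □)Q′G′²Q′*hC(□)h)(y, y′)| ≦ O(1)e^{−¼δ₀M}(Lʲη)⁴ Σ_{□: y∉□} Σ_{y″∈supp h}
e^{−½δ₀d(y,y″)}|C(□; y″, y′)|» — the factor `O(1)(Lʲη)⁴e^{−½δ₀d(y,y″)}` is the kernel bound of `Q′G′²Q′*` obtained from (3.42)₁ for each `G′` «(Lʲη)²e^{−δ₀d}»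
by composition ((2.52) p. 232 «A composition of operators preserves the above property, we have (T₁T₂λ)(x) … Σ_{y″} K₁(y,y″)K₂(y″,y′)|λ|») with the scale
transfer of the weights (p. 234 (2.60), B9 p. 398 «(Lʲη)^γ e^{−αδ₀d(y,y′)} ≦ (L^{j′}η)^γ·const») and Lemma 2.1 (2.61) p. 234 «sup_y Σ_{y′} e^{−αδ₀d(y,y′)} ≦ c₁(α)».
B9 = [Balaban1985BackgroundPropagators] p. 411 (3.95)–(3.96), p. 397 (3.42).  Rows B9.Eq3.95 × B4.Eq2.83 × B4.Eq2.52 × B9.Thm3.1 (cells only).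

WHY THIS FILE.  M5.6 FILE 2 (`B9Thm39CinvFirstSum.firstSum_term_majorant_blk`) takes the upper majorant `hL : κ·P(a)⁻¹·e^{−a_Lδ₀d}` of `L = Q′G′²Q′*`
(`P(a) = ℓ(a)⁻⁴`) as displayed input.  Its mathematical content is the COMPOSITION of the two (3.42)₁ majorants `B·ℓ(a)²·e^{−δd}` of `η²G′(U)` (M5.5's
output) — a weighted product that needs the scale transfer to move `ℓ(a″)²` to `ℓ(a)²` and (2.61) to sum the middle point.  THIS FILE proves that
composition ONCE, generically (any geometry of [4]'s calculus, any block map, any weights), and packages it through `B9Eq352DivFormLetters.conj b` (real coordinates); the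
`Q′( · )Q′*` sandwich at def-Y's letters (block averaging with unitary transporters, a contraction between the site and block carriers) is FILE 3b.

WHAT IS PROVED (all `theorem`s, 0 `def`, 0 sorry, 0 new named facts).
* ★★ `hasMajorant_mul_weighted` — if `T₁ ≺ B₁w₁(a)e^{−δd}`, `T₂ ≺ B₂w₂(a)e^{−δd}` (block majorants, block map `blk`), the weight `w₂` transfers at exponent
  `α_st` with constant `C` (`B9Ineq347.ScaleTransfer g δ α_st C w₂`), (2.61) holds at `((1−α_st)δ, α′)`, (2.54), `d ≥ 0`, `0 ≤ α_stδ`, `0 ≤ α′`, `α′ ≤ 1`: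
  `T₁T₂ ≺ B₁B₂C·c₁·w₁(a)w₂(a)·e^{−(1−α′)(1−α_st)δ·d(a,a′)}` ([4] (2.52) + (2.60) + (2.61)).
* ★ `hasMajorant_conj_mul_weighted` — the same for `B9Eq352DivFormLetters.conj b (s₁•T₁) * B9Eq352DivFormLetters.conj b (s₂•T₂) = B9Eq352DivFormLetters.conj b ((s₁s₂)•(T₁T₂))` on any `𝔸`-valued carrier (so for
  `η²G′ · η²G′ = η⁴G′²` at def-Y's site carrier: `B²C c₁·ℓ(a)⁴·e^{−(1−α′)(1−α_st)δd}` — (2.83)'s «O(1)(Lʲη)⁴e^{−½δ₀d(y,y″)}» with O(1) and ½ explicit).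

HONEST SCOPE.  Bookkeeping in [4]'s block-majorant calculus (pv08 `B6RandomWalk.hasMajorant_mul`); the (3.42)₁ majorants, the scale transfer and (2.61)
are hypotheses of the printed shape (at the member: M5.5's ★★, `B9RWSums346Schur.scaleTransfer_len_rpow`, FILE 1 §5 of M5.5); nothing of [B9]/[4]
asserted beyond what is proved; NOT summit progress.  RELATED, NOT DUPLICATED (searched 2026-08-28 `lean search 'hasMajorant_mul_weighted|mul_weighted' --decl`
= ∅): `B6RandomWalk.hasMajorant_mul` (unweighted composition), r06 `B9Thm39Sum.firstSum_term_majorant` (does the transfer INSIDE the (2.83) term, with `P⁻¹`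
on the left factor only), `B9Ineq347AllEntries.glob347_of_342_weighted` (the (3.47) sums, one operator).
-/

noncomputable section

namespace Literature.MathematicalPhysics.QuantumFieldTheory.Balaban1983to89.B9Thm39CinvUpperL

open Literature.MathematicalPhysics.QuantumFieldTheory.Balaban1983to89
open Finset

/-! ## §1 The weighted composition ([4] (2.52) + (2.60) + (2.61)) -/

section Weighted

variable {g : B9.Geometry} [Fintype g.Site] {R : ℝ} {H : Prop} {X : Type}

/-- ★★ **COMPOSITION OF TWO SCALE-WEIGHTED MAJORANTS** ([4] (2.52) «Σ_{y″} K₁(y,y″)K₂(y″,y′)», the weight of the middle point moved to the left point by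
the scale transfer (2.60)/p. 398 and the middle sum done by (2.61)): `T₁ ≺ B₁w₁(a)e^{−δd}`, `T₂ ≺ B₂w₂(a)e^{−δd}` ⟹
`T₁T₂ ≺ B₁B₂C·c₁((1−α_st)δ, α′)·w₁(a)w₂(a)·e^{−(1−α′)(1−α_st)δd(a,a′)}`.
[cite: Balaban1984PropagatorsII, (2.52) p.232 + (2.60)–(2.61) p.234; Balaban1985BackgroundPropagators, p.398 (scale transfer), (2.83)-use p.411] -/
theorem hasMajorant_mul_weighted (blk : X → g.Site) (d : ℕ) {δ αst α' B₁ B₂ C : ℝ} (w₁ w₂ : g.Site → ℝ)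
    (hB₁ : 0 ≤ B₁) (hB₂ : 0 ≤ B₂) (hC : 0 ≤ C) (hw₁ : ∀ a, 0 ≤ w₁ a) (hw₂ : ∀ a, 0 ≤ w₂ a)
    (hαδ : 0 ≤ αst * δ) (hα'0 : 0 ≤ α') (hα'1 : α' ≤ 1) (hδ' : 0 ≤ (1 - αst) * δ)
    (htri : B6RandomWalk.Triangle254 (B9Thm34Ext.toB6 g R H)) (hdnn : ∀ a a' : g.Site, 0 ≤ g.dist a a')
    (hST : B9Ineq347.ScaleTransfer g δ αst C w₂) (h261 : B6RandomWalk.Ineq261 d (B9Thm34Ext.toB6 g R H) ((1 - αst) * δ) α')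
    {T₁ T₂ : Module.End ℝ (X → ℝ)}
    (h₁ : B6RandomWalk.HasMajorant (g := B9Thm34Ext.toB6 g R H) blk T₁ (fun a a' => B₁ * w₁ a * Real.exp (-(δ * g.dist a a'))))
    (h₂ : B6RandomWalk.HasMajorant (g := B9Thm34Ext.toB6 g R H) blk T₂ (fun a a' => B₂ * w₂ a * Real.exp (-(δ * g.dist a a')))) :
    B6RandomWalk.HasMajorant (g := B9Thm34Ext.toB6 g R H) blk (T₁ * T₂)
      (fun a a' => B₁ * B₂ * C * B6.c1 d ((1 - αst) * δ) α' * (w₁ a * w₂ a) *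
        Real.exp (-((1 - α') * ((1 - αst) * δ) * g.dist a a'))) := by
  have hK₂ : ∀ a a' : g.Site, 0 ≤ B₂ * w₂ a * Real.exp (-(δ * g.dist a a')) := fun a a' =>
    mul_nonneg (mul_nonneg hB₂ (hw₂ a)) (Real.exp_nonneg _)
  refine B6RandomWalk.hasMajorant_mono (g := B9Thm34Ext.toB6 g R H) _ (B6RandomWalk.hasMajorant_mul (g := B9Thm34Ext.toB6 g R H) blk h₁ h₂ hK₂) fun a a' => ?_
  set δ' : ℝ := (1 - αst) * δ with hδ'def
  have hpre : 0 ≤ B₁ * w₁ a * B₂ := mul_nonneg (mul_nonneg hB₁ (hw₁ a)) hB₂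
  have hpreC : 0 ≤ B₁ * w₁ a * B₂ * (C * w₂ a) := mul_nonneg hpre (mul_nonneg hC (hw₂ a))
  -- termwise: move `w₂(a″)` to `w₂(a)` (scale transfer), lower the second rate to `δ′`, triangle inequality
  have hterm : ∀ a'' : g.Site,
      B₁ * w₁ a * Real.exp (-(δ * g.dist a a'')) * (B₂ * w₂ a'' * Real.exp (-(δ * g.dist a'' a'))) ≤
        B₁ * B₂ * C * (w₁ a * w₂ a) * Real.exp (-((1 - α') * δ' * g.dist a a')) * Real.exp (-(α' * δ' * g.dist a a'')) := by
    intro a''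
    have hsplit : Real.exp (-(δ * g.dist a a'')) = Real.exp (-(αst * δ * g.dist a a'')) * Real.exp (-(δ' * g.dist a a'')) := by
      rw [← Real.exp_add, hδ'def]; ring_nf
    have hst : Real.exp (-(αst * δ * g.dist a a'')) * w₂ a'' ≤ C * w₂ a := hST a a''
    have hmono : Real.exp (-(δ * g.dist a'' a')) ≤ Real.exp (-(δ' * g.dist a'' a')) := by
      refine Real.exp_le_exp.mpr ?_
      have h1 : 0 ≤ αst * δ * g.dist a'' a' := mul_nonneg hαδ (hdnn a'' a')
      have h2 : δ' * g.dist a'' a' = δ * g.dist a'' a' - αst * δ * g.dist a'' a' := by rw [hδ'def]; ring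
      linarith
    have htri' : Real.exp (-(δ' * g.dist a a'')) * Real.exp (-(δ' * g.dist a'' a')) ≤
        Real.exp (-((1 - α') * δ' * g.dist a a')) * Real.exp (-(α' * δ' * g.dist a a'')) := by
      rw [← Real.exp_add, ← Real.exp_add]
      refine Real.exp_le_exp.mpr ?_
      have h0 : g.dist a a' ≤ g.dist a a'' + g.dist a'' a' := htri a a'' a'
      have h1 := mul_le_mul_of_nonneg_left h0 (mul_nonneg (sub_nonneg.2 hα'1) hδ')
      have h2 : 0 ≤ α' * δ' * g.dist a'' a' := mul_nonneg (mul_nonneg hα'0 hδ') (hdnn a'' a')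
      nlinarith [h1, h2]
    calc B₁ * w₁ a * Real.exp (-(δ * g.dist a a'')) * (B₂ * w₂ a'' * Real.exp (-(δ * g.dist a'' a')))
        = B₁ * w₁ a * B₂ * (Real.exp (-(αst * δ * g.dist a a'')) * w₂ a'') *
            (Real.exp (-(δ' * g.dist a a'')) * Real.exp (-(δ * g.dist a'' a'))) := by rw [hsplit]; ring
      _ ≤ B₁ * w₁ a * B₂ * (C * w₂ a) * (Real.exp (-(δ' * g.dist a a'')) * Real.exp (-(δ * g.dist a'' a'))) :=
          mul_le_mul_of_nonneg_right (mul_le_mul_of_nonneg_left hst hpre) (mul_nonneg (Real.exp_nonneg _) (Real.exp_nonneg _))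
      _ ≤ B₁ * w₁ a * B₂ * (C * w₂ a) * (Real.exp (-(δ' * g.dist a a'')) * Real.exp (-(δ' * g.dist a'' a'))) :=
          mul_le_mul_of_nonneg_left (mul_le_mul_of_nonneg_left hmono (Real.exp_nonneg _)) hpreC
      _ ≤ B₁ * w₁ a * B₂ * (C * w₂ a) * (Real.exp (-((1 - α') * δ' * g.dist a a')) * Real.exp (-(α' * δ' * g.dist a a''))) :=
          mul_le_mul_of_nonneg_left htri' hpreC
      _ = _ := by ring
  have hpref : 0 ≤ B₁ * B₂ * C * (w₁ a * w₂ a) * Real.exp (-((1 - α') * δ' * g.dist a a')) :=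
    mul_nonneg (mul_nonneg (mul_nonneg (mul_nonneg hB₁ hB₂) hC) (mul_nonneg (hw₁ a) (hw₂ a))) (Real.exp_nonneg _)
  calc ∑ a'' : g.Site, B₁ * w₁ a * Real.exp (-(δ * g.dist a a'')) * (B₂ * w₂ a'' * Real.exp (-(δ * g.dist a'' a')))
      ≤ ∑ a'' : g.Site, B₁ * B₂ * C * (w₁ a * w₂ a) * Real.exp (-((1 - α') * δ' * g.dist a a')) *
          Real.exp (-(α' * δ' * g.dist a a'')) := Finset.sum_le_sum fun a'' _ => hterm a''
    _ = B₁ * B₂ * C * (w₁ a * w₂ a) * Real.exp (-((1 - α') * δ' * g.dist a a')) *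
          ∑ a'' : g.Site, Real.exp (-(α' * δ' * g.dist a a'')) := by rw [Finset.mul_sum]
    _ ≤ B₁ * B₂ * C * (w₁ a * w₂ a) * Real.exp (-((1 - α') * δ' * g.dist a a')) * B6.c1 d δ' α' :=
        mul_le_mul_of_nonneg_left (h261 a) hpref
    _ = _ := by ring

end Weighted

/-! ## §2 The same through `B9Eq352DivFormLetters.conj b` (real coordinates of `𝔸`-valued letters), with scale weights -/

section Conj

variable {𝔸 : Type} [NormedRing 𝔸] [NormedAlgebra ℂ 𝔸]
variable {ι : Type} [Fintype ι] (b : Module.Basis ι ℝ 𝔸)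
variable {g : B9.Geometry} [Fintype g.Site] {R : ℝ} {H : Prop} {S : Type}

/-- ★ **THE SCALED LETTERS' PRODUCT IN REAL COORDINATES**: majorants `B₁w₁(a)e^{−δd}` of `B9Eq352DivFormLetters.conj b (s₁•T₁)` and `B₂w₂(a)e^{−δd}` of `B9Eq352DivFormLetters.conj b (s₂•T₂)` give the
majorant `B₁B₂C·c₁·w₁(a)w₂(a)·e^{−(1−α′)(1−α_st)δd}` of `B9Eq352DivFormLetters.conj b ((s₁s₂)•(T₁T₂))` — for `η²G′·η²G′ = η⁴G′²` at the site carrier this is (2.83)'s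
«O(1)(Lʲη)⁴e^{−½δ₀d(y,y″)}» with `O(1) = B²Cc₁` and the rate explicit. [cite: Balaban1984PropagatorsII, (2.83) p.237 + (2.52) p.232; Balaban1985BackgroundPropagators, (3.95) p.411] -/
theorem hasMajorant_conj_mul_weighted (blk : S × ι → g.Site) (d : ℕ) {δ αst α' B₁ B₂ C : ℝ} (w₁ w₂ : g.Site → ℝ) (s₁ s₂ : ℝ)
    (hB₁ : 0 ≤ B₁) (hB₂ : 0 ≤ B₂) (hC : 0 ≤ C) (hw₁ : ∀ a, 0 ≤ w₁ a) (hw₂ : ∀ a, 0 ≤ w₂ a)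
    (hαδ : 0 ≤ αst * δ) (hα'0 : 0 ≤ α') (hα'1 : α' ≤ 1) (hδ' : 0 ≤ (1 - αst) * δ)
    (htri : B6RandomWalk.Triangle254 (B9Thm34Ext.toB6 g R H)) (hdnn : ∀ a a' : g.Site, 0 ≤ g.dist a a')
    (hST : B9Ineq347.ScaleTransfer g δ αst C w₂) (h261 : B6RandomWalk.Ineq261 d (B9Thm34Ext.toB6 g R H) ((1 - αst) * δ) α')
    {T₁ T₂ : Module.End ℝ (S → 𝔸)}
    (h₁ : B6RandomWalk.HasMajorant (g := B9Thm34Ext.toB6 g R H) blk (B9Eq352DivFormLetters.conj b (s₁ • T₁)) (fun a a' => B₁ * w₁ a * Real.exp (-(δ * g.dist a a'))))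
    (h₂ : B6RandomWalk.HasMajorant (g := B9Thm34Ext.toB6 g R H) blk (B9Eq352DivFormLetters.conj b (s₂ • T₂)) (fun a a' => B₂ * w₂ a * Real.exp (-(δ * g.dist a a')))) :
    B6RandomWalk.HasMajorant (g := B9Thm34Ext.toB6 g R H) blk (B9Eq352DivFormLetters.conj b ((s₁ * s₂) • (T₁ * T₂)))
      (fun a a' => B₁ * B₂ * C * B6.c1 d ((1 - αst) * δ) α' * (w₁ a * w₂ a) *
        Real.exp (-((1 - α') * ((1 - αst) * δ) * g.dist a a'))) := by
  have hrw : B9Eq352DivFormLetters.conj b ((s₁ * s₂) • (T₁ * T₂)) = B9Eq352DivFormLetters.conj b (s₁ • T₁) * B9Eq352DivFormLetters.conj b (s₂ • T₂) := by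
    rw [← B9Eq352DivFormLetters.conj_mul, smul_mul_smul_comm]
  rw [hrw]
  exact hasMajorant_mul_weighted blk d w₁ w₂ hB₁ hB₂ hC hw₁ hw₂ hαδ hα'0 hα'1 hδ' htri hdnn hST h261 h₁ h₂

end Conj


end Literature.MathematicalPhysics.QuantumFieldTheory.Balaban1983to89.B9Thm39CinvUpperL

end
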